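/-
Copyright: the b2b-balaban T⁴-continuum CRUX team, row NE7b OWNER lineage `t4-ne7b-p1` (gen 118). Project licence.
-/
import Summits.QuantumFields.BalabanUV.T4Continuum.Spine.NE7b.SupConvexStepSemigroup

/-!
# THE LETTERS OF THE CONVEX CLASS: a Hessian floor `m·Σ h² ≤ S″(φ) h h` gives strong monotonicity of the gradient
# `m·Σ(ψ − φ)² ≤ (S′ ψ − S′ φ)(ψ − φ)` and the first-order letter of (110)'s class (so the second-order class of (111) lies in the
# first-order class with the same modulus); conversely the first-order letter gives strong monotonicity; and in the class with `m > 0`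
# THE GRADIENT IS A BIJECTION ONTO THE DUAL: every covector `L` is `S′ φ` for exactly one `φ` (the tilted action `S − L` has exactly
# one critical point) — the Legendre dual of every action in the class, in particular of every effective action of the convex tower,
# is defined on the whole dual carrier
# (row NE7b, node U5c; (110) + (93) BY NAME; [folklore])

Cell `pub-balaban`, sub-cell `t4`, spine estimate NE7b (`T4WeightBudget.RelWeightBound`; the cell's OWN estimate — NOT PRINTED in
[Bałaban 1983–89], NOT PROVED).  Crux-route work under `Spine/NE7b/` by the row OWNER (`t4-ne7b-p1` gen 118) under FREEZE (0)'s
crux-prover clause (the abstract convexity column); NOTHING of Bałaban's is named as a Lean object, valued or asserted; no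
`T4Continuum/Support` leaf typed; no `def`, no notation; zero `sorry`.  Imports (BY NAME): the OWNER's (110) `…SupConvexStepSemigroup`
(`line_hasDerivAt`, `step_closure`; through it (93) `exists_isMinOn_of_firstOrder`, (92) ∕ TEA for the torus instance).

WHY (located).  (111) carries the first-order letter AND the Hessian floor as separate hypotheses; the floor implies the letter (two
mean-value steps along the segment, (92)'s argument made abstract), so the second-order class needs one hypothesis fewer.  (106) made
the torus next equation a bijection; abstractly this is "the gradient of a `C¹` strongly convex function is a bijection onto the dual"
and applies verbatim to every floor of the tower produced by (110)∕(111).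

WHAT IS PROVED ([folklore]):
* §1 `gradient_line_hasDerivAt` (`t ↦ S′(φ + t•h) h` has derivative `S″(φ + t•h) h h`), **`gradient_strongMonotone_of_floor`**
  (`m·Σ(ψ − φ)² ≤ (S′ ψ − S′ φ)(ψ − φ)`), **`firstOrder_of_floor`** (the first-order letter with modulus `m` from `HasFDerivAt S (S′ φ) φ`,
  `HasFDerivAt S′ (S″ φ) φ` and the floor), `gradient_strongMonotone_of_firstOrder` (conversely, the letter gives monotonicity).
* §2 **`gradient_bijective`** (class with `m > 0`: `∀ L, ∃! φ, S′ φ = L`).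
* §3 **`fibreMin_gradient_bijective`** (for the fibre minimum of (110)'s step: every covector on the coarse carrier is `(S′(Φ w))∘M`
  for exactly one block field `w`).
* §4 toy.

HONEST (what this is NOT).  Abstract finite-dimensional convex analysis; no moduli beyond `m`; nothing about the measure; scalar
skeleton ((A3), NC-NE7b-α UNRULED); nothing of Bałaban's.  BY-NAME EFFECT ON THE WALL: NONE.  NE7b NOT PRINTED ∕ NOT PROVED; spine
PROVED 0∕9; rung (B)+1 on a FINITE torus — NOT infinite volume, NOT the mass gap, NOT Clay.  HONEST DEPENDENCY: continuum YM on T⁴ ⇐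
BetaPertH ∧ nine spine estimates (0∕9 proved); BetaPertH ⇐ (D1) ∧ (D4) ∧ CAP+tail; G-an2-4 gates asym, D1 and NE2∕3∕4.
-/

set_option autoImplicit false

noncomputable section

namespace Summit.QuantumFields.BalabanUV.T4Continuum.NE7b.SupConvexClassGradient

open Set Function Filter Metric
open scoped Topology
open SupTorusActionMinimiser (exists_isMinOn_of_firstOrder)
open SupConvexStepSemigroup (line_hasDerivAt step_closure)

/-! ## §1. Floor ⟹ strong monotonicity ⟹ first-order letter -/

section Letters

variable {ι : Type*} [Fintype ι] {S : (ι → ℝ) → ℝ} {S' : (ι → ℝ) → (ι → ℝ) →L[ℝ] ℝ}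
  {S'' : (ι → ℝ) → (ι → ℝ) →L[ℝ] (ι → ℝ) →L[ℝ] ℝ} {m : ℝ}

/-- **THE GRADIENT ALONG A LINE**: `t ↦ S′(φ + t•h) h` has derivative `S″(φ + t•h) h h`. [folklore] -/
theorem gradient_line_hasDerivAt (hS2 : ∀ φ, HasFDerivAt S' (S'' φ) φ) (φ h : ι → ℝ) (t : ℝ) :
    HasDerivAt (fun t : ℝ => S' (φ + t • h) h) (S'' (φ + t • h) h h) t := by
  have hline : HasDerivAt (fun t : ℝ => φ + t • h) ((1 : ℝ) • h) t := ((hasDerivAt_id t).smul_const h).const_add φ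
  have hc : HasDerivAt (fun t : ℝ => S' (φ + t • h)) (S'' (φ + t • h) ((1 : ℝ) • h)) t :=
    (hS2 (φ + t • h)).comp_hasDerivAt t hline
  rw [one_smul] at hc
  have happ := hc.clm_apply (hasDerivAt_const t h)
  simpa using happ

/-- **A HESSIAN FLOOR MAKES THE GRADIENT STRONGLY MONOTONE**: `HasFDerivAt S′ (S″ φ) φ` and `m·Σ h² ≤ S″ φ h h` everywhere ⟹
`m·Σ_x (ψ x − φ x)² ≤ S′ ψ (ψ − φ) − S′ φ (ψ − φ)`. [folklore] -/
theorem gradient_strongMonotone_of_floor (hS2 : ∀ φ, HasFDerivAt S' (S'' φ) φ)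
    (hfl : ∀ φ h : ι → ℝ, m * ∑ x, h x ^ 2 ≤ S'' φ h h) (φ ψ : ι → ℝ) :
    m * ∑ x, (ψ x - φ x) ^ 2 ≤ S' ψ (ψ - φ) - S' φ (ψ - φ) := by
  set h : ι → ℝ := ψ - φ with hh
  set q : ℝ := ∑ x, h x ^ 2 with hq
  -- `f t = S′(φ + t•h) h − m·t·q` is monotone on `t ≥ 0`
  set f : ℝ → ℝ := fun t => S' (φ + t • h) h - m * t * q with hf
  have hf' : ∀ t, HasDerivAt f (S'' (φ + t • h) h h - m * q) t := fun t => by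
    have h1 := gradient_line_hasDerivAt hS2 φ h t
    have h2 : HasDerivAt (fun t : ℝ => m * t * q) (m * 1 * q) t := ((hasDerivAt_id t).const_mul m).mul_const q
    exact (h1.sub h2).congr_deriv (by ring)
  have hmono : MonotoneOn f (Ici (0 : ℝ)) := by
    refine monotoneOn_of_deriv_nonneg (convex_Ici 0) (fun t _ => (hf' t).continuousAt.continuousWithinAt)
      (fun t _ => (hf' t).differentiableAt.differentiableWithinAt) fun t _ => ?_
    rw [(hf' t).deriv]
    linarith [hfl (φ + t • h) h]
  have h01 := hmono (Set.mem_Ici.2 (le_refl (0 : ℝ))) (Set.mem_Ici.2 (zero_le_one : (0 : ℝ) ≤ 1)) zero_le_one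
  simp only [hf, zero_smul, add_zero, mul_zero, zero_mul, sub_zero, one_smul, mul_one] at h01
  have hψ : φ + h = ψ := by rw [hh]; abel
  rw [hψ] at h01
  have hq' : ∑ x, (ψ x - φ x) ^ 2 = q := by rw [hq]; exact Finset.sum_congr rfl fun x _ => by simp [hh]
  rw [hq']
  linarith

/-- **THE FIRST-ORDER LETTER FROM THE FLOOR**: `HasFDerivAt S (S′ φ) φ`, `HasFDerivAt S′ (S″ φ) φ`, `m·Σ h² ≤ S″ φ h h` ⟹
`S φ + S′ φ (ψ − φ) + ½m·Σ(ψ − φ)² ≤ S ψ` — the second-order class of (111) lies in the first-order class of (110). [folklore] -/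
theorem firstOrder_of_floor (hS : ∀ φ, HasFDerivAt S (S' φ) φ) (hS2 : ∀ φ, HasFDerivAt S' (S'' φ) φ)
    (hfl : ∀ φ h : ι → ℝ, m * ∑ x, h x ^ 2 ≤ S'' φ h h) (φ ψ : ι → ℝ) :
    S φ + S' φ (ψ - φ) + m / 2 * ∑ x, (ψ x - φ x) ^ 2 ≤ S ψ := by
  set h : ι → ℝ := ψ - φ with hh
  set q : ℝ := ∑ x, h x ^ 2 with hq
  set g : ℝ → ℝ := fun t => S (φ + t • h) with hg
  set D0 : ℝ := S' φ h with hD0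
  set k : ℝ → ℝ := fun t => g t - t * D0 - m / 2 * t ^ 2 * q with hk
  have hg' : ∀ t, HasDerivAt g (S' (φ + t • h) h) t := fun t => line_hasDerivAt hS φ h t
  have hk' : ∀ t, HasDerivAt k (S' (φ + t • h) h - D0 - m * t * q) t := by
    intro t
    have h1 : HasDerivAt (fun t : ℝ => t * D0) (1 * D0) t := (hasDerivAt_id t).mul_const D0
    have h2 : HasDerivAt (fun t : ℝ => m / 2 * t ^ 2 * q) (m / 2 * ((2 : ℕ) * t ^ (2 - 1)) * q) t :=
      ((hasDerivAt_pow 2 t).const_mul (m / 2)).mul_const q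
    refine (((hg' t).sub h1).sub h2).congr_deriv ?_
    push_cast
    ring
  -- `k′(t) ≥ 0` for `t ≥ 0` by strong monotonicity between `φ` and `φ + t•h`
  have hk'nonneg : ∀ t : ℝ, 0 ≤ t → 0 ≤ S' (φ + t • h) h - D0 - m * t * q := by
    intro t ht
    have hmono := gradient_strongMonotone_of_floor hS2 hfl φ (φ + t • h)
    have e1 : (φ + t • h) - φ = t • h := by abel
    have e2 : ∑ x, ((φ + t • h) x - φ x) ^ 2 = t ^ 2 * q := by
      rw [hq, Finset.mul_sum]; exact Finset.sum_congr rfl fun x _ => by simp; ring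
    rw [e1, e2, map_smul, map_smul, smul_eq_mul, smul_eq_mul] at hmono
    rcases ht.eq_or_lt with h0 | hpos
    · rw [← h0]; simp [hD0]
    · have h' : t * (m * t * q) ≤ t * (S' (φ + t • h) h - D0) := by
        calc t * (m * t * q) = m * (t ^ 2 * q) := by ring
          _ ≤ t * S' (φ + t • h) h - t * S' φ h := hmono
          _ = t * (S' (φ + t • h) h - D0) := by rw [hD0]; ring
      have := le_of_mul_le_mul_left h' hpos
      linarith
  have hmonoK : MonotoneOn k (Ici (0 : ℝ)) := by
    refine monotoneOn_of_deriv_nonneg (convex_Ici 0) (fun t _ => (hk' t).continuousAt.continuousWithinAt)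
      (fun t _ => (hk' t).differentiableAt.differentiableWithinAt) fun t ht => ?_
    rw [interior_Ici] at ht
    rw [(hk' t).deriv]
    exact hk'nonneg t (le_of_lt ht)
  have h01 := hmonoK (Set.mem_Ici.2 (le_refl (0 : ℝ))) (Set.mem_Ici.2 (zero_le_one : (0 : ℝ) ≤ 1)) zero_le_one
  have hk0 : k 0 = S φ := by simp [hk, hg]
  have hk1 : k 1 = S ψ - D0 - m / 2 * q := by
    have hψ : φ + (1 : ℝ) • h = ψ := by rw [one_smul, hh]; abel
    simp only [hk, hg, hψ]; ring
  rw [hk0, hk1] at h01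
  have hq' : ∑ x, (ψ x - φ x) ^ 2 = q := by rw [hq]; exact Finset.sum_congr rfl fun x _ => by simp [hh]
  rw [hq']
  linarith

/-- **CONVERSELY, THE FIRST-ORDER LETTER GIVES STRONG MONOTONICITY**: `m·Σ(ψ − φ)² ≤ S′ ψ (ψ − φ) − S′ φ (ψ − φ)`. [folklore] -/
theorem gradient_strongMonotone_of_firstOrder
    (hfo : ∀ φ ψ : ι → ℝ, S φ + S' φ (ψ - φ) + m / 2 * ∑ x, (ψ x - φ x) ^ 2 ≤ S ψ) (φ ψ : ι → ℝ) :
    m * ∑ x, (ψ x - φ x) ^ 2 ≤ S' ψ (ψ - φ) - S' φ (ψ - φ) := by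
  have h1 := hfo φ ψ
  have h2 := hfo ψ φ
  have hsymm : ∑ x, (φ x - ψ x) ^ 2 = ∑ x, (ψ x - φ x) ^ 2 := Finset.sum_congr rfl fun x _ => by ring
  have hneg : S' ψ (φ - ψ) = -(S' ψ (ψ - φ)) := by rw [← map_neg, neg_sub]
  rw [hsymm, hneg] at h2
  linarith

end Letters

/-! ## §2. The gradient is a bijection onto the dual -/

section Bijective

variable {ι : Type*} [Fintype ι] {S : (ι → ℝ) → ℝ} {S' : (ι → ℝ) → (ι → ℝ) →L[ℝ] ℝ} {m : ℝ}

/-- **THE GRADIENT OF A FUNCTION IN THE CLASS IS A BIJECTION ONTO THE DUAL** (`HasFDerivAt S (S′ φ) φ`, first-order letter with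
`m > 0`): for every covector `L` there is EXACTLY ONE `φ` with `S′ φ = L` — the unique minimiser of the tilted action `S − L`.
[folklore] -/
theorem gradient_bijective (hS : ∀ φ, HasFDerivAt S (S' φ) φ)
    (hfo : ∀ φ ψ : ι → ℝ, S φ + S' φ (ψ - φ) + m / 2 * ∑ x, (ψ x - φ x) ^ 2 ≤ S ψ) (hm : 0 < m)
    (L : (ι → ℝ) →L[ℝ] ℝ) : ∃! φ : ι → ℝ, S' φ = L := by
  -- existence: minimise the tilt
  have hcont : Continuous (fun φ : ι → ℝ => S φ - L φ) :=
    (continuous_iff_continuousAt.2 fun φ => (hS φ).continuousAt).sub L.continuous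
  have hfoT : ∀ ψ ∈ (univ : Set (ι → ℝ)),
      (S 0 - L 0) + (S' 0 - L) (ψ - 0) + m / 2 * ∑ x, (ψ x - (0 : ι → ℝ) x) ^ 2 ≤ S ψ - L ψ := by
    intro ψ _
    have h1 := hfo 0 ψ
    simp only [sub_apply, map_zero, sub_zero, Pi.zero_apply] at h1 ⊢
    linarith
  obtain ⟨φ, -, hmin⟩ := exists_isMinOn_of_firstOrder hcont isClosed_univ (mem_univ (0 : ι → ℝ)) hm hfoT
  have hder : HasFDerivAt (fun φ : ι → ℝ => S φ - L φ) (S' φ - L) φ := (hS φ).sub L.hasFDerivAt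
  have hzero := (hmin.isLocalMin univ_mem).hasFDerivAt_eq_zero hder
  refine ⟨φ, sub_eq_zero.1 hzero, fun ψ hψ => ?_⟩
  -- uniqueness: strong monotonicity
  have hmono := gradient_strongMonotone_of_firstOrder hfo φ ψ
  rw [hψ, sub_eq_zero.1 hzero, sub_self] at hmono
  have hsq : ∑ x, (ψ x - φ x) ^ 2 = 0 :=
    le_antisymm (nonpos_of_mul_nonpos_right hmono hm) (Finset.sum_nonneg fun x _ => sq_nonneg _)
  funext x
  have hx := (Finset.sum_eq_zero_iff_of_nonneg fun x _ => sq_nonneg (ψ x - φ x)).1 hsq x (Finset.mem_univ x)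
  rw [sq_eq_zero_iff, sub_eq_zero] at hx
  exact hx

end Bijective

/-! ## §3. The gradient of the fibre minimum is a bijection onto the coarse dual -/

section FibreMin

variable {ι κ : Type*} [Fintype ι] [Fintype κ] {S : (ι → ℝ) → ℝ} {S' : (ι → ℝ) → (ι → ℝ) →L[ℝ] ℝ} {m : ℝ}

/-- **EVERY COARSE COVECTOR IS THE GRADIENT OF THE FIBRE MINIMUM AT EXACTLY ONE BLOCK FIELD**: class with `m > 0`; `Qt` with a
right inverse `M` and block Jensen constant `vol > 0`; `Φ` the fibre-critical map of (110)'s step (`Qt(Φ w) = w`, `S′(Φ w)` kills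
`ker Qt`).  Then `∀ L, ∃! w, (S′(Φ w))∘M = L`. [folklore] -/
theorem fibreMin_gradient_bijective (hS : ∀ φ, HasFDerivAt S (S' φ) φ)
    (hfo : ∀ φ ψ : ι → ℝ, S φ + S' φ (ψ - φ) + m / 2 * ∑ x, (ψ x - φ x) ^ 2 ≤ S ψ) (hm : 0 < m)
    (Qt : (ι → ℝ) →L[ℝ] (κ → ℝ)) (M : (κ → ℝ) →L[ℝ] (ι → ℝ)) (hM : ∀ k : κ → ℝ, Qt (M k) = k) {vol : ℝ} (hvol : 0 < vol)
    (hJ : ∀ h : ι → ℝ, vol * ∑ y, Qt h y ^ 2 ≤ ∑ x, h x ^ 2)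
    {Φ : (κ → ℝ) → (ι → ℝ)} (hΦQ : ∀ w, Qt (Φ w) = w) (hΦcrit : ∀ (w : κ → ℝ) (h : ι → ℝ), Qt h = 0 → S' (Φ w) h = 0)
    (L : (κ → ℝ) →L[ℝ] ℝ) : ∃! w : κ → ℝ, (S' (Φ w)).comp M = L := by
  obtain ⟨Ψ, hΨQ, hΨcrit, -, huniq, hW, hWfo⟩ := step_closure hS hfo hm Qt M hM hJ
  have hΦΨ : Φ = Ψ := huniq Φ hΦQ hΦcrit
  subst hΦΨ
  exact gradient_bijective (S := fun w : κ → ℝ => S (Φ w)) (S' := fun w => (S' (Φ w)).comp M) (m := m * vol) hW hWfo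
    (mul_pos hm hvol) L

end FibreMin

/-! ## §4. Toy -/

/-- Toy (§2 on one site: `S φ = Σ φ²`, `S′ φ = 2⟨φ, –⟩`, modulus `2`): every covector is a gradient at exactly one point. -/
example (L : (Unit → ℝ) →L[ℝ] ℝ) :
    ∃! φ : Unit → ℝ, (2 * φ ()) • ContinuousLinearMap.proj (R := ℝ) (φ := fun _ : Unit => ℝ) () = L := by
  have hd : ∀ φ : Unit → ℝ, HasFDerivAt (fun φ : Unit → ℝ => ∑ x, φ x ^ 2)
      ((2 * φ ()) • ContinuousLinearMap.proj (R := ℝ) (φ := fun _ : Unit => ℝ) ()) φ := by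
    intro φ
    have h1 : (fun φ : Unit → ℝ => ∑ x, φ x ^ 2) = fun φ => φ () ^ 2 := by funext φ; simp
    rw [h1]
    have h2 := ((ContinuousLinearMap.proj (R := ℝ) (φ := fun _ : Unit => ℝ) ()).hasFDerivAt (x := φ)).pow 2
    simpa using h2
  refine gradient_bijective (m := 2) hd (fun φ ψ => ?_) two_pos L
  simp only [Finset.univ_unique, PUnit.default_eq_unit, Finset.sum_singleton, smul_apply,
    ContinuousLinearMap.proj_apply, Pi.sub_apply, smul_eq_mul]
  nlinarith [sq_nonneg (ψ () - φ ())]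

end Summit.QuantumFields.BalabanUV.T4Continuum.NE7b.SupConvexClassGradient

end
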